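import Summits.BirchSwinnertonDyer.BirchSwinnertonDyer.Theorems.ManinLocalTwoThreeThirdLatticeVelu
import HarnessLib

/-!
# THE `3`-ADIC Γ₀/Γ₁ DEFECT LAW as an IFF: `|c₀| = 3|c₁|` ⟺ Shimura index `9`, or index `3` with a NON-ascending kernel line;
# an untripled index-`3` Shimura cover makes the kernel line's Vélu `3`-quotient ASCEND (`u = 3`)

Summit `BirchSwinnertonDyer`, route `ManinLocalTwoThree` (cell bsd-f2-manin), crux C3 `ManinPrimeToThreeAtNine`
(stmt-BirchSwinnertonDyer-22968); lead p1 gen 14; the `3`-adic twin of `…ShimuraKernelBlindNecessary` / `…ShimuraDefectLawAtTwo`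
(p = 2, this gen).  For the optimal `X₁(N)`/`X₀(N)` pair `(D₁, D₀)` of a class at `9 ∣ N` the ledger gives `|c₀| ∈ {|c₁|, 3|c₁|}`
(`natAbs_maninConstant₀_eq_or_eq_three_mul_of_nine_dvd_level`) and Ling–Oesterlé `3Λ₀(f) ⊆ Λ₁(f) ⊆ Λ₀(f)`, index
`s ∈ {1, 3, 9}`.  The tree held the TRIPLED direction (`index_nine_or_velu_three_of_tripled`, p3/lead g6: `|c₀| = 3|c₁|` ⟹
`s = 9` or the minimal `W₁` carries the `u = 1` Vélu pair `(1440q² − 9c₄, 60480q³ − 756c₄q − 27c₆)` of `W₀` at a rational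
`Ψ₃`-root).  THIS FILE adds the UNTRIPLED direction and the law as an IFF, at the CANONICAL kernel point `q = ℘(c₀w/3)`,
`w ∈ Λ₁(f) ∖ 3Λ₀(f)`:

* `velu_three_ascends_at_of_natAbs_eq` — **`|c₀| = |c₁|` and `Λ₁(f) ≠ Λ₀(f)` ⟹ for every `w ∈ Λ₁(f) ∖ 3Λ₀(f)` the kernel
  abscissa `q = ℘_{Λ₀}(c₀w/3)` is RATIONAL, `q − b₂/12` is a root of `W₀.Ψ₃` (a rational `3`-isogeny kernel), and the minimal
  `W₁` carries the ASCENDED pair: `3⁴·c₄(W₁) = 1440q² − 9c₄(W₀)`, `3⁶·c₆(W₁) = 60480q³ − 756c₄(W₀)q − 27c₆(W₀)`** (the Vélu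
  `3`-quotient of `W₀` by the kernel line is NOT minimal at `3`: `u(W₀ → W₀/⟨T⟩) = 3`) — third-lattice trichotomy on
  `Λ_{E₀} ⊆ ⅓Λ_{E₁}` (index `9` is excluded by the ledger, index `1` by `Λ₁ ≠ Λ₀`) + `velu_three_rigidity`;
* `velu_three_unit_at_of_natAbs_eq_three_mul` — the tripled direction AT THE CANONICAL POINT: `|c₀| = 3|c₁|`, not index `9`
  ⟹ at `q = ℘(c₀w/3)` the minimal `W₁` carries the `u = 1` pair;
* `natAbs_maninConstant₀_eq_three_mul_iff_index_nine_or_not_ascends` — **THE IFF**: `|c₀| = 3|c₁|` ⟺ `Λ₁(f) = 3Λ₀(f)` ∨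
  (`Λ₁(f) ≠ Λ₀(f)` ∧ no `w ∈ Λ₁(f) ∖ 3Λ₀(f)` has an ascended kernel pair) — the two pairs at one `q` cannot both be `(c₄, c₆)(W₁)`
  since `80·c₄(W₁) = 728·c₆(W₁) = 0` would make `Δ(W₁) = 0`.

So at `p = 3` the Γ₀/Γ₁ defect is EXACTLY (Shimura index, minimality at `3` of the Vélu `3`-quotient by the kernel line): the
`3`-adic answer to the cell's search question at this interface, as a theorem.  HONEST FRAMING: which alternative HOLDS (the law
«index-`3` kernel lines always ascend», cf. NB₃^V / E-an-66(3)) stays OPEN; no Manin constant is decided; C3, Manin's conjecture and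
BSD are not proved by this.  No definitions, no named facts, no sorry.
-/

set_option autoImplicit false
-- the summit-side namespace `Summit.BirchSwinnertonDyer.BirchSwinnertonDyer.…` is the tree's (summit = sub-problem)
set_option linter.dupNamespace false

noncomputable section

open WeierstrassCurve Literature.NumberTheory.EllipticCurves Literature.NumberTheory.EllipticCurves.ModularForms
open CongruenceSubgroup Polynomial

namespace Summit.BirchSwinnertonDyer.BirchSwinnertonDyer.Theorems.ManinLocalTwoThree

variable {W₁ W₀ : WeierstrassCurve ℚ} [W₁.IsElliptic] [W₁.IsGloballyMinimal] [W₀.IsElliptic]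
  [W₀.IsGloballyMinimal] {N : ℕ} [NeZero N]

/-! ## §1 Untripled, index `3`: the kernel line's Vélu quotient ascends -/

omit [W₁.IsGloballyMinimal] [W₀.IsGloballyMinimal] in
/-- **`|c₀| = |c₁|` and `Λ₁(f) ≠ Λ₀(f)` make the kernel line's Vélu `3`-quotient ASCEND.**  For the optimal `X₁(N)`-datum `D₁`
and a lattice-optimal `X₀(N)`-datum `D₀` of two isogenous globally minimal curves, `9 ∣ N`, untripled constants and a non-trivial
Shimura kernel: for every `w ∈ Λ₁(f) ∖ 3Λ₀(f)`, `q = ℘_{Λ_{E₀}}(c₀w/3)` is rational, `q − b₂/12` is a root of `W₀.Ψ₃`, and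
`81·c₄(W₁) = 1440q² − 9c₄(W₀)`, `729·c₆(W₁) = 60480q³ − 756c₄(W₀)q − 27c₆(W₀)` (the `u = 3` descent of the Vélu pair is the
MINIMAL pair of the class's Stevens curve).  (Pure lattice algebra: the minimality instances are not used.) -/
theorem velu_three_ascends_at_of_natAbs_eq (D₁ : Gamma1ParametrizationData W₁ N) (D₀ : ModularParametrizationData W₀ N)
    (hiso : IsIsogenous W₁ W₀) (h₁ : D₁.IsOptimal)
    (h₀ : ∀ z ∈ D₀.L.lattice, ∃ w ∈ periodLattice D₀.f, z = D₀.c * w) (h9 : 3 ^ 2 ∣ N)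
    (heq : D₀.maninConstant.natAbs = D₁.maninConstant.natAbs)
    (hΛne : periodLatticeGamma1 D₀.f ≠ periodLattice D₀.f)
    {w : ℂ} (hw : w ∈ periodLatticeGamma1 D₀.f) (hw3 : ∀ v ∈ periodLattice D₀.f, w ≠ 3 * v) :
    ∃ q : ℚ, (q : ℂ) = D₀.L.weierstrassP ((D₀.c : ℂ) * w / 3) ∧ W₀.Ψ₃.eval (q - W₀.b₂ / 12) = 0 ∧
      81 * W₁.c₄ = 1440 * q ^ 2 - 9 * W₀.c₄ ∧ 729 * W₁.c₆ = 60480 * q ^ 3 - 756 * W₀.c₄ * q - 27 * W₀.c₆ := by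
  have hf : D₁.f = D₀.f := D₁.f_eq_of_isIsogenous D₀ hiso
  have hc₁ : (D₁.c : ℂ) ≠ 0 := by exact_mod_cast D₁.maninConstant_ne_zero
  have hc₀ : (D₀.c : ℂ) ≠ 0 := by exact_mod_cast D₀.maninConstant_ne_zero_holds
  have hc₄W₁ : (W₁.baseChange ℂ).c₄ = (W₁.c₄ : ℂ) := by simp [WeierstrassCurve.baseChange, WeierstrassCurve.map_c₄]
  have hc₆W₁ : (W₁.baseChange ℂ).c₆ = (W₁.c₆ : ℂ) := by simp [WeierstrassCurve.baseChange, WeierstrassCurve.map_c₆]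
  -- `c₀ = ε c₁`
  obtain ⟨ε, hε, hcc⟩ : ∃ ε : ℂ, (ε = 1 ∨ ε = -1) ∧ (D₀.c : ℂ) = ε * D₁.c := by
    rcases Int.natAbs_eq_natAbs_iff.mp heq with h' | h'
    · exact ⟨1, Or.inl rfl, by rw [one_mul]; exact_mod_cast h'⟩
    · exact ⟨-1, Or.inr rfl, by rw [neg_one_mul]; exact_mod_cast h'⟩
  have hε2 : ε * ε = 1 := by rcases hε with rfl | rfl <;> norm_num
  have hεmem : ∀ (S : AddSubgroup ℂ) (y : ℂ), y ∈ S → ε * y ∈ S := by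
    intro S y hy; rcases hε with rfl | rfl
    · rwa [one_mul]
    · rw [neg_one_mul]; exact neg_mem hy
  -- Ling–Oesterlé at `3`
  have h3Λ : ∀ v ∈ periodLattice D₀.f, (3 : ℂ) * v ∈ periodLatticeGamma1 D₀.f := fun v hv ↦ by
    have h := pMulLatticeLeGamma1OfTracelessPrime_holds N D₀.f D₀.isNewformOf.1 3 Nat.prime_three
      ((dvd_pow_self 3 two_ne_zero).trans h9) (D₀.isNewformOf.1.cuspCoeff_eq_zero_of_sq_dvd Nat.prime_three h9) v hv
    exact_mod_cast h
  -- `H = ⅓Λ_{E₁}`: rational invariants, `Λ_{E₀} ⊆ H`, `3H ⊆ Λ_{E₀}`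
  set H : PeriodPair := D₁.L.mulLeft ((3 : ℂ)⁻¹) (inv_ne_zero three_ne_zero) with hH
  have hHmem : ∀ z, z ∈ H.lattice ↔ 3 * z ∈ D₁.L.lattice := fun z ↦ by
    rw [hH, PeriodPair.mem_mulLeft_lattice, inv_inv]
  have hA : ((81 * W₁.c₄ / 12 : ℚ) : ℂ) = H.g₂ := by
    rw [hH, PeriodPair.g₂_mulLeft, D₁.isNeronLattice.1, hc₄W₁]; push_cast; ring
  have hB : ((729 * W₁.c₆ / 216 : ℚ) : ℂ) = H.g₃ := by
    rw [hH, PeriodPair.g₃_mulLeft, D₁.isNeronLattice.2, hc₆W₁]; push_cast; ring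
  have hle : D₀.L.lattice ≤ H.lattice := by
    intro z hz
    obtain ⟨v, hv, rfl⟩ := h₀ z hz
    rw [hHmem]
    have e : 3 * ((D₀.c : ℂ) * v) = (D₁.c : ℂ) * (ε * (3 * v)) := by rw [hcc]; ring
    rw [e]
    exact D₁.smul_periodLatticeGamma1_le _ (hεmem _ _ (by rw [hf]; exact h3Λ v hv))
  have hthree : ∀ y ∈ H.lattice, 3 * y ∈ D₀.L.lattice := by
    intro y hy
    rw [hHmem] at hy
    obtain ⟨w₁, hw₁, hw₁'⟩ := h₁ _ hy
    have hw₀ : ε * w₁ ∈ periodLattice D₀.f := hεmem _ _ (hf ▸ periodLatticeGamma1_le_periodLattice D₁.f hw₁)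
    have e : 3 * y = (D₀.c : ℂ) * (ε * w₁) := by
      rw [hw₁', hcc]; linear_combination -((D₁.c : ℂ) * w₁) * hε2
    rw [e]; exact D₀.smul_periodLattice_le _ hw₀
  -- the kernel point `z₀ = c₀ w / 3`
  set z₀ : ℂ := (D₀.c : ℂ) * w / 3 with hz₀def
  have hz₀H : z₀ ∈ H.lattice := by
    rw [hHmem, show 3 * z₀ = (D₁.c : ℂ) * (ε * w) by rw [hz₀def, hcc]; ring]
    exact D₁.smul_periodLatticeGamma1_le _ (by rw [hf]; exact hεmem _ _ hw)
  have hz₀ : z₀ ∉ D₀.L.lattice := by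
    intro h
    obtain ⟨v, hv, hv'⟩ := h₀ _ h
    refine hw3 v hv (mul_left_cancel₀ hc₀ ?_)
    linear_combination (3 : ℂ) * hv'
  rcases thirdLattice_trichotomy D₀.L H hle hthree with hcase | hcase | hcase
  · -- `⅓Λ_{E₁} ⊆ Λ_{E₀}` (index 9): then `z₀ ∈ Λ_{E₀}` — excluded by `w ∉ 3Λ₀`
    exact absurd (hcase _ hz₀H) hz₀
  · -- `⅓Λ_{E₀} ⊆ ⅓Λ_{E₁}`: `Λ₀ ⊆ Λ₁` — excluded by `Λ₁ ≠ Λ₀`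
    exfalso
    refine hΛne (le_antisymm (periodLatticeGamma1_le_periodLattice D₀.f) fun v hv ↦ ?_)
    have h3h : 3 * ((D₀.c : ℂ) * v * 3⁻¹) ∈ D₀.L.lattice := by
      rw [show 3 * ((D₀.c : ℂ) * v * 3⁻¹) = (D₀.c : ℂ) * v by ring]; exact D₀.smul_periodLattice_le v hv
    have hH' := hcase _ h3h
    rw [hHmem, show 3 * ((D₀.c : ℂ) * v * 3⁻¹) = (D₀.c : ℂ) * v by ring] at hH'
    obtain ⟨w₁, hw₁, hw₁'⟩ := h₁ _ hH'
    have hv' : v = ε * w₁ := by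
      have h : (D₁.c : ℂ) * v = (D₁.c : ℂ) * (ε * w₁) := by
        rw [hcc] at hw₁'
        linear_combination ε * hw₁' - ((D₁.c : ℂ) * v) * hε2
      exact mul_left_cancel₀ hc₁ h
    rw [hv', ← hf]; exact hεmem _ _ hw₁
  · -- index 3: `H = Λ_{E₀} ∪ (±z₀ + Λ_{E₀})`; Vélu rigidity at `z₀`
    obtain ⟨z₁, hz₁', hz₁, hidx₁⟩ := hcase
    have hidx : ∀ y ∈ H.lattice, y ∈ D₀.L.lattice ∨ y - z₀ ∈ D₀.L.lattice ∨ y + z₀ ∈ D₀.L.lattice := by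
      rcases hidx₁ z₀ hz₀H with h | h | h
      · exact absurd h hz₀
      · intro y hy
        rcases hidx₁ y hy with h' | h' | h'
        · exact Or.inl h'
        · right; left
          have e' : y - z₀ = (y - z₁) - (z₀ - z₁) := by ring
          rw [e']; exact sub_mem h' h
        · right; right
          have e' : y + z₀ = (y + z₁) + (z₀ - z₁) := by ring
          rw [e']; exact add_mem h' h
      · intro y hy
        rcases hidx₁ y hy with h' | h' | h'
        · exact Or.inl h'
        · right; right
          have e' : y + z₀ = (y - z₁) + (z₀ + z₁) := by ring
          rw [e']; exact add_mem h' h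
        · right; left
          have e' : y - z₀ = (y + z₁) - (z₀ + z₁) := by ring
          rw [e']; exact sub_mem h' h
    obtain ⟨q, hq, hroot, hA', hB'⟩ :=
      velu_three_rigidity D₀.isNeronLattice H hA hB hle hz₀H hz₀ (hthree z₀ hz₀H) hidx
    refine ⟨q, hq, hroot, ?_, ?_⟩
    · linear_combination 12 * hA'
    · linear_combination 216 * hB'

/-! ## §2 Tripled, index `3`: the `u = 1` pair at the canonical kernel point -/

/-- **`|c₀| = 3|c₁|`, not index `9` ⟹ the minimal `W₁` carries the `u = 1` Vélu pair at the canonical kernel point** — the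
pointwise form of `index_nine_or_velu_three_of_tripled` (third-lattice trichotomy on `Λ_{E₀} ⊆ Λ_{E₁}`): for every
`w ∈ Λ₁(f) ∖ 3Λ₀(f)`, `q = ℘(c₀w/3)` is rational, `W₀.Ψ₃(q − b₂/12) = 0`, `c₄(W₁) = 1440q² − 9c₄(W₀)` and
`c₆(W₁) = 60480q³ − 756c₄(W₀)q − 27c₆(W₀)`. -/
theorem velu_three_unit_at_of_natAbs_eq_three_mul (D₁ : Gamma1ParametrizationData W₁ N)
    (D₀ : ModularParametrizationData W₀ N) (hiso : IsIsogenous W₁ W₀) (h₁ : D₁.IsOptimal)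
    (h₀ : ∀ z ∈ D₀.L.lattice, ∃ w ∈ periodLattice D₀.f, z = D₀.c * w) (h9 : 3 ^ 2 ∣ N)
    (htri : D₀.maninConstant.natAbs = 3 * D₁.maninConstant.natAbs)
    (hne9 : ¬ (∀ z : ℂ, z ∈ periodLatticeGamma1 D₀.f ↔ ∃ w ∈ periodLattice D₀.f, z = 3 * w))
    {w : ℂ} (hw : w ∈ periodLatticeGamma1 D₀.f) (hw3 : ∀ v ∈ periodLattice D₀.f, w ≠ 3 * v) :
    ∃ q : ℚ, (q : ℂ) = D₀.L.weierstrassP ((D₀.c : ℂ) * w / 3) ∧ W₀.Ψ₃.eval (q - W₀.b₂ / 12) = 0 ∧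
      W₁.c₄ = 1440 * q ^ 2 - 9 * W₀.c₄ ∧ W₁.c₆ = 60480 * q ^ 3 - 756 * W₀.c₄ * q - 27 * W₀.c₆ := by
  have hf : D₁.f = D₀.f := D₁.f_eq_of_isIsogenous D₀ hiso
  have hc₁ : (D₁.c : ℂ) ≠ 0 := by exact_mod_cast D₁.maninConstant_ne_zero
  have hc₀ : (D₀.c : ℂ) ≠ 0 := by exact_mod_cast D₀.maninConstant_ne_zero_holds
  have hc₄W₁ : (W₁.baseChange ℂ).c₄ = (W₁.c₄ : ℂ) := by simp [WeierstrassCurve.baseChange, WeierstrassCurve.map_c₄]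
  have hc₆W₁ : (W₁.baseChange ℂ).c₆ = (W₁.c₆ : ℂ) := by simp [WeierstrassCurve.baseChange, WeierstrassCurve.map_c₆]
  have hA : ((W₁.c₄ / 12 : ℚ) : ℂ) = D₁.L.g₂ := by rw [D₁.isNeronLattice.1, hc₄W₁]; push_cast; ring
  have hB : ((W₁.c₆ / 216 : ℚ) : ℂ) = D₁.L.g₃ := by rw [D₁.isNeronLattice.2, hc₆W₁]; push_cast; ring
  -- Ling–Oesterlé at `3`
  have h3Λ : ∀ v ∈ periodLattice D₀.f, (3 : ℂ) * v ∈ periodLatticeGamma1 D₀.f := fun v hv ↦ by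
    have h := pMulLatticeLeGamma1OfTracelessPrime_holds N D₀.f D₀.isNewformOf.1 3 Nat.prime_three
      ((dvd_pow_self 3 two_ne_zero).trans h9) (D₀.isNewformOf.1.cuspCoeff_eq_zero_of_sq_dvd Nat.prime_three h9) v hv
    exact_mod_cast h
  obtain ⟨ε, hε, hcc⟩ : ∃ ε : ℂ, (ε = 1 ∨ ε = -1) ∧ (D₀.c : ℂ) = ε * (3 * D₁.c) := by
    have h : D₀.maninConstant.natAbs = (3 * D₁.maninConstant).natAbs := by rw [htri, Int.natAbs_mul]; rfl
    rcases Int.natAbs_eq_natAbs_iff.mp h with h' | h'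
    · exact ⟨1, Or.inl rfl, by rw [one_mul]; exact_mod_cast h'⟩
    · exact ⟨-1, Or.inr rfl, by rw [neg_one_mul]; exact_mod_cast h'⟩
  have hε2 : ε * ε = 1 := by rcases hε with rfl | rfl <;> norm_num
  have hεmem : ∀ (S : AddSubgroup ℂ) (y : ℂ), y ∈ S → ε * y ∈ S := by
    intro S y hy; rcases hε with rfl | rfl
    · rwa [one_mul]
    · rw [neg_one_mul]; exact neg_mem hy
  have hle : D₀.L.lattice ≤ D₁.L.lattice := by
    intro z hz
    obtain ⟨v, hv, rfl⟩ := h₀ z hz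
    have e : (D₀.c : ℂ) * v = (D₁.c : ℂ) * (ε * (3 * v)) := by rw [hcc]; ring
    rw [e]
    exact D₁.smul_periodLatticeGamma1_le _ (hεmem _ _ (by rw [hf]; exact h3Λ v hv))
  have hthree : ∀ y ∈ D₁.L.lattice, 3 * y ∈ D₀.L.lattice := by
    intro y hy
    obtain ⟨w₁, hw₁, rfl⟩ := h₁ y hy
    have hw₀ : ε * w₁ ∈ periodLattice D₀.f := hεmem _ _ (hf ▸ periodLatticeGamma1_le_periodLattice D₁.f hw₁)
    have e : 3 * ((D₁.c : ℂ) * w₁) = (D₀.c : ℂ) * (ε * w₁) := by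
      rw [hcc]; linear_combination -(3 * (D₁.c : ℂ) * w₁) * hε2
    rw [e]; exact D₀.smul_periodLattice_le _ hw₀
  -- the kernel point `z₀ = c₀ w / 3 = ε c₁ w`
  set z₀ : ℂ := (D₀.c : ℂ) * w / 3 with hz₀def
  have hz₀' : z₀ ∈ D₁.L.lattice := by
    rw [show z₀ = (D₁.c : ℂ) * (ε * w) by rw [hz₀def, hcc]; ring]
    exact D₁.smul_periodLatticeGamma1_le _ (by rw [hf]; exact hεmem _ _ hw)
  have hz₀ : z₀ ∉ D₀.L.lattice := by
    intro h
    obtain ⟨v, hv, hv'⟩ := h₀ _ h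
    refine hw3 v hv (mul_left_cancel₀ hc₀ ?_)
    linear_combination (3 : ℂ) * hv'
  rcases thirdLattice_trichotomy D₀.L D₁.L hle hthree with hcase | hcase | hcase
  · -- `Λ_{E₁} = Λ_{E₀}`: index `9`, excluded
    exfalso
    apply hne9
    refine fun z ↦ ⟨fun hz ↦ ?_, by rintro ⟨v, hv, rfl⟩; exact h3Λ v hv⟩
    have hz' : (D₁.c : ℂ) * z ∈ D₀.L.lattice := hcase _ (D₁.smul_periodLatticeGamma1_le z (hf ▸ hz))
    obtain ⟨v, hv, hv'⟩ := h₀ _ hz'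
    refine ⟨ε * v, hεmem _ _ hv, ?_⟩
    have h : (D₁.c : ℂ) * z = (D₁.c : ℂ) * (3 * (ε * v)) := by rw [hv', hcc]; ring
    exact mul_left_cancel₀ hc₁ h
  · -- `Λ_{E₁} ⊇ ⅓Λ_{E₀}`: `Λ₁ = Λ₀`, so `|c₀| = |c₁|`, contradicting tripling
    exfalso
    have hΛ : periodLatticeGamma1 D₀.f = periodLattice D₀.f := by
      refine le_antisymm (periodLatticeGamma1_le_periodLattice D₀.f) fun v hv ↦ ?_
      have h3h : 3 * (ε * ((D₁.c : ℂ) * v)) ∈ D₀.L.lattice := by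
        have e : 3 * (ε * ((D₁.c : ℂ) * v)) = (D₀.c : ℂ) * v := by rw [hcc]; ring
        rw [e]; exact D₀.smul_periodLattice_le v hv
      obtain ⟨w₁, hw₁, hw₁'⟩ := h₁ _ (hcase _ h3h)
      have hv' : v = ε * w₁ := by
        have h : (D₁.c : ℂ) * v = (D₁.c : ℂ) * (ε * w₁) := by
          linear_combination ε * hw₁' - ((D₁.c : ℂ) * v) * hε2
        exact mul_left_cancel₀ hc₁ h
      rw [hv', ← hf]; exact hεmem _ _ hw₁
    have heq := natAbs_maninConstant₀_eq_of_periodLatticeGamma1_eq_periodLattice D₁ D₀ h₁ h₀ hf hΛ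
    have hne : D₁.maninConstant.natAbs ≠ 0 := Int.natAbs_ne_zero.mpr D₁.maninConstant_ne_zero
    omega
  · -- index `3`: Vélu rigidity at the canonical point `z₀`
    obtain ⟨z₁, hz₁', hz₁, hidx₁⟩ := hcase
    have hidx : ∀ y ∈ D₁.L.lattice, y ∈ D₀.L.lattice ∨ y - z₀ ∈ D₀.L.lattice ∨ y + z₀ ∈ D₀.L.lattice := by
      rcases hidx₁ z₀ hz₀' with h | h | h
      · exact absurd h hz₀
      · intro y hy
        rcases hidx₁ y hy with h' | h' | h'
        · exact Or.inl h'
        · right; left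
          have e' : y - z₀ = (y - z₁) - (z₀ - z₁) := by ring
          rw [e']; exact sub_mem h' h
        · right; right
          have e' : y + z₀ = (y + z₁) + (z₀ - z₁) := by ring
          rw [e']; exact add_mem h' h
      · intro y hy
        rcases hidx₁ y hy with h' | h' | h'
        · exact Or.inl h'
        · right; right
          have e' : y + z₀ = (y - z₁) + (z₀ + z₁) := by ring
          rw [e']; exact add_mem h' h
        · right; left
          have e' : y - z₀ = (y + z₁) - (z₀ + z₁) := by ring
          rw [e']; exact sub_mem h' h
    obtain ⟨q, hq, hroot, hA', hB'⟩ :=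
      velu_three_rigidity D₀.isNeronLattice D₁.L hA hB hle hz₀' hz₀ (hthree z₀ hz₀') hidx
    refine ⟨q, hq, hroot, ?_, ?_⟩
    · linear_combination 12 * hA'
    · linear_combination 216 * hB'

/-! ## §3 The `3`-adic defect law -/

/-- **THE `3`-ADIC Γ₀/Γ₁ DEFECT LAW (iff).**  For the optimal `X₁(N)`-datum `D₁` and a lattice-optimal `X₀(N)`-datum `D₀` of two
isogenous globally minimal curves, `9 ∣ N`: `|c₀| = 3|c₁|` **iff** EITHER the Shimura index is `9` (`Λ₁(f) = 3Λ₀(f)`) OR the index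
is `3` (`Λ₁(f) ≠ Λ₀(f)`) and NO `w ∈ Λ₁(f) ∖ 3Λ₀(f)` has an ASCENDED kernel pair (`81c₄(W₁) = 1440q² − 9c₄(W₀)`,
`729c₆(W₁) = …` at `q = ℘(c₀w/3)`).  (`⟸`: index `9` triples by `natAbs_maninConstant₀_eq_three_mul_of_index_nine`; at index `3`
untripled constants would give an ascended pair, §1.  `⟹`: §2 gives the `u = 1` pair at the same `q`; both pairs at once force
`80c₄(W₁) = 0 = 728c₆(W₁)`, i.e. `Δ(W₁) = 0`.) -/
theorem natAbs_maninConstant₀_eq_three_mul_iff_index_nine_or_not_ascends (D₁ : Gamma1ParametrizationData W₁ N)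
    (D₀ : ModularParametrizationData W₀ N) (hiso : IsIsogenous W₁ W₀) (h₁ : D₁.IsOptimal)
    (h₀ : ∀ z ∈ D₀.L.lattice, ∃ w ∈ periodLattice D₀.f, z = D₀.c * w) (h9 : 3 ^ 2 ∣ N) :
    D₀.maninConstant.natAbs = 3 * D₁.maninConstant.natAbs ↔
      ((∀ z : ℂ, z ∈ periodLatticeGamma1 D₀.f ↔ ∃ w ∈ periodLattice D₀.f, z = 3 * w) ∨
        (periodLatticeGamma1 D₀.f ≠ periodLattice D₀.f ∧
          ∀ w ∈ periodLatticeGamma1 D₀.f, (∀ v ∈ periodLattice D₀.f, w ≠ 3 * v) →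
            ¬ ∃ q : ℚ, (q : ℂ) = D₀.L.weierstrassP ((D₀.c : ℂ) * w / 3) ∧
              81 * W₁.c₄ = 1440 * q ^ 2 - 9 * W₀.c₄ ∧
              729 * W₁.c₆ = 60480 * q ^ 3 - 756 * W₀.c₄ * q - 27 * W₀.c₆)) := by
  have hf : D₁.f = D₀.f := D₁.f_eq_of_isIsogenous D₀ hiso
  have hne : D₁.maninConstant.natAbs ≠ 0 := Int.natAbs_ne_zero.mpr D₁.maninConstant_ne_zero
  have hΔW₁ : W₁.Δ ≠ 0 := by rw [← WeierstrassCurve.coe_Δ']; exact W₁.Δ'.ne_zero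
  have h3Λ : ∀ v ∈ periodLattice D₀.f, (3 : ℂ) * v ∈ periodLatticeGamma1 D₀.f := fun v hv ↦ by
    have h := pMulLatticeLeGamma1OfTracelessPrime_holds N D₀.f D₀.isNewformOf.1 3 Nat.prime_three
      ((dvd_pow_self 3 two_ne_zero).trans h9) (D₀.isNewformOf.1.cuspCoeff_eq_zero_of_sq_dvd Nat.prime_three h9) v hv
    exact_mod_cast h
  constructor
  · intro htri
    by_cases hidx9 : ∀ z : ℂ, z ∈ periodLatticeGamma1 D₀.f ↔ ∃ w ∈ periodLattice D₀.f, z = 3 * w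
    · exact Or.inl hidx9
    · refine Or.inr ⟨fun hΛ ↦ ?_, fun w hw hw3 ↦ ?_⟩
      · have heq := natAbs_maninConstant₀_eq_of_periodLatticeGamma1_eq_periodLattice D₁ D₀ h₁ h₀ hf hΛ
        omega
      · rintro ⟨q, hq, hA3, hB3⟩
        obtain ⟨q', hq', -, hA1, hB1⟩ :=
          velu_three_unit_at_of_natAbs_eq_three_mul D₁ D₀ hiso h₁ h₀ h9 htri hidx9 hw hw3
        have hqq : q = q' := by exact_mod_cast hq.trans hq'.symm
        subst hqq
        have hc₄ : W₁.c₄ = 0 := by linear_combination (1 / 80 : ℚ) * (hA3 - hA1)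
        have hc₆ : W₁.c₆ = 0 := by linear_combination (1 / 728 : ℚ) * (hB3 - hB1)
        apply hΔW₁
        have h := W₁.c_relation
        rw [hc₄, hc₆] at h
        linear_combination (1 / 1728 : ℚ) * h
  · rintro (hidx9 | ⟨hΛne, hna⟩)
    · exact natAbs_maninConstant₀_eq_three_mul_of_index_nine D₁ D₀ h₁ h₀ (fun z ↦ by rw [hf]; exact hidx9 z)
    · rcases natAbs_maninConstant₀_eq_or_eq_three_mul_of_nine_dvd_level D₁ D₀ hiso h₁ h₀ h9 with heq | htri
      · by_cases hsub : ∀ w ∈ periodLatticeGamma1 D₀.f, ∃ v ∈ periodLattice D₀.f, w = 3 * v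
        · exact natAbs_maninConstant₀_eq_three_mul_of_index_nine D₁ D₀ h₁ h₀ (fun z ↦ by
            rw [hf]; exact ⟨hsub z, by rintro ⟨v, hv, rfl⟩; exact h3Λ v hv⟩)
        · exfalso
          push Not at hsub
          obtain ⟨w, hw, hw3⟩ := hsub
          obtain ⟨q, hq, -, hA3, hB3⟩ := velu_three_ascends_at_of_natAbs_eq D₁ D₀ hiso h₁ h₀ h9 heq hΛne hw hw3
          exact hna w hw hw3 ⟨q, hq, hA3, hB3⟩
      · exact htri

end Summit.BirchSwinnertonDyer.BirchSwinnertonDyer.Theorems.ManinLocalTwoThree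

end
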